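import Literature.Probability.Percolation.InterfaceTraversalBoundData
import HarnessLib

/-!
# Multiple shell crossings by the bond interface of ARBITRARY discrete Dobrushin data, II:
taint lemmas and the data of a traversal

Topic: Probability / Percolation. Second file of the verbatim generalisation of
`InterfaceTraversalBound.lean` (Aizenman–Burchard, Duke Math. J. 99 (1999), Appendix A, for the
medial exploration path of critical bond percolation on `δℤ²`) from the canonical data
`dobrushinData D δ` to arbitrary data `⟨D.carrier, δ, arcA, arcB⟩` (`arcA arcB : Set ℂ` free;
see `InterfaceTraversalBoundData.lean` for the rationale). Contents:

* the **taint lemmas** of Part II (`exists_frontier_of_leftTaint_data`,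
  `exists_frontier_of_rightTaint_data`): a left vertex on the wired arc, resp. a corner of a
  right face on the dual-wired arc, produces a point of `∂D` in the corresponding side
  component of the annulus minus the perturbed polygon;
* the first step of Part III (`dist_polyline_cv_le_data`, `tIdx_lt_data`,
  `traversal_data_data`): from a traversal of a shell by the polygon to a stretch of darts with
  a middle dart whose side segment lies in the annulus.

References: M. Aizenman, A. Burchard, Duke Math. J. 99 (1999) 419–453, Appendix A;
S. Smirnov, C. R. Acad. Sci. Paris 333 (2001), §2.
-/

noncomputable section

open MeasureTheory Metric Set Filter Topology
open scoped Pointwise unitInterval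

namespace Literature.Probability.Percolation

open LatticeModels LatticeModels.IsMedialExploration

variable {Dm : RandomPlanarGeometry.DobrushinDomain} {δ : ℝ} {arcA arcB : Set ℂ}
  {ω : BondConfig (Site 2)} {a : MedialVertex} {l : List MedialVertex}

/-! ### Tainted chain steps -/

/-- **A left vertex on the wired arc produces a boundary point in the left component**
(arbitrary arcs). If the `4δ`-neighbourhoods of the vertices of the darts `i₀, …, i₁` lie in `A`
and some vertex `vᵢ` of the stretch lies on the discrete arc `A` (so on `∂Ω_δ`), then some point
of `∂D` within `2δ` of `δvᵢ` lies in the component, in `A` minus the perturbed polygon, of every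
`δv_m` of the stretch. [cite: AizenmanBurchardDuke1999, Appendix A] -/
theorem exists_frontier_of_leftTaint_data (hδ : 0 < δ)
    (hexp : IsMedialExploration (⟨Dm.carrier, δ, arcA, arcB⟩ : DiscreteDobrushin) ω (a :: l)) {A : Set ℂ} {i₀ i₁ m i : ℕ}
    (hi₁ : i₁ < ((a :: l).zip l).length)
    (hball : ∀ j, i₀ ≤ j → j ≤ i₁ → closedBall (meshPoint δ (hexp.cv j)) (4 * δ) ⊆ A)
    (hm₀ : i₀ ≤ m) (hm : m ≤ i₁) (hi₀ : i₀ ≤ i) (hi : i ≤ i₁)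
    (hiA : hexp.cv i ∈ (⟨Dm.carrier, δ, arcA, arcB⟩ : DiscreteDobrushin).zdArcA) :
    ∃ z ∈ frontier Dm.carrier, z ∈ connectedComponentIn (A \ hexp.pertTrace) (meshPoint δ (hexp.cv m)) ∧
      dist z (meshPoint δ (hexp.cv i)) ≤ 2 * δ := by
  have hδ' : 0 < (⟨Dm.carrier, δ, arcA, arcB⟩ : DiscreteDobrushin).δ := hδ
  obtain ⟨z, hzfr, hzd, hfree⟩ := exists_frontier_near_of_mem_zdBoundary_data hδ hexp
    ((⟨Dm.carrier, δ, arcA, arcB⟩ : DiscreteDobrushin).zdArcA_subset_zdBoundary hiA)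
  refine ⟨z, hzfr, ?_, hzd⟩
  have hball' : ∀ j, i₀ ≤ j → j ≤ i₁ → closedBall (meshPoint δ (hexp.cv j)) δ ⊆ A := fun j h1 h2 =>
    (closedBall_subset_closedBall (by linarith)).trans (hball j h1 h2)
  have h1 := hexp.cv_mem_connectedComponentIn hδ' hi₁ hball' hi₀ hi hm₀ hm
  dsimp only at h1
  rw [connectedComponentIn_eq h1]
  have hseg : segment ℝ (meshPoint δ (hexp.cv i)) z ⊆ A \ hexp.pertTrace := fun q hq =>
    ⟨hball i hi₀ hi ((convex_closedBall _ _).segment_subset (mem_closedBall.2 (by rw [dist_self]; positivity)) (mem_closedBall.2 (by linarith)) hq), hfree q hq⟩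
  exact (convex_segment _ _).isPreconnected.subset_connectedComponentIn (left_mem_segment _ _ _) hseg
    (right_mem_segment _ _ _)

/-- **A corner on the dual-wired arc of a right face produces a boundary point in the right
component** (arbitrary arcs). If some corner `u'` of a face `fᵢ` of the stretch lies on the
discrete arc `B`, then some point of `∂D` within `4δ` of `δvᵢ` lies in the component of every
face centre of the stretch: the half-diagonal from the centre of `fᵢ` to `u'` misses the polygon
(no dart has the `B`-site `u'` as its left vertex, `cv_not_mem_zdArcB`).
[cite: AizenmanBurchardDuke1999, Appendix A] -/
theorem exists_frontier_of_rightTaint_data (hδ : 0 < δ) (hadm : (⟨Dm.carrier, δ, arcA, arcB⟩ : DiscreteDobrushin).IsZdAdmissible)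
    (hexp : IsMedialExploration (⟨Dm.carrier, δ, arcA, arcB⟩ : DiscreteDobrushin) ω (a :: l)) {A : Set ℂ} {i₀ i₁ m i : ℕ}
    (hi₁ : i₁ < ((a :: l).zip l).length)
    (hball : ∀ j, i₀ ≤ j → j ≤ i₁ → closedBall (meshPoint δ (hexp.cv j)) (4 * δ) ⊆ A)
    (hm₀ : i₀ ≤ m) (hm : m ≤ i₁) (hi₀ : i₀ ≤ i) (hi : i ≤ i₁) {u' : Site 2}
    (hu' : IsCorner u' (hexp.cf i)) (hB : u' ∈ (⟨Dm.carrier, δ, arcA, arcB⟩ : DiscreteDobrushin).zdArcB) :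
    ∃ z ∈ frontier Dm.carrier,
      z ∈ connectedComponentIn (A \ hexp.pertTrace) (δ • faceCenter (hexp.cf m)) ∧
      dist z (meshPoint δ (hexp.cv i)) ≤ 4 * δ := by
  have hδ' : 0 < (⟨Dm.carrier, δ, arcA, arcB⟩ : DiscreteDobrushin).δ := hδ
  have hin : i < ((a :: l).zip l).length := by omega
  obtain ⟨z, hzfr, hzd, hfree⟩ := exists_frontier_near_of_mem_zdBoundary_data hδ hexp
    ((⟨Dm.carrier, δ, arcA, arcB⟩ : DiscreteDobrushin).zdArcB_subset_zdBoundary hB)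
  -- distances to `δvᵢ`
  have hu'd : dist (meshPoint δ u') (meshPoint δ (hexp.cv i)) ≤ 2 * δ := by
    have := closedSq_subset_closedBall (hexp.isCorner hin) (toComplex_mem_closedSq hu')
    rw [mem_closedBall] at this
    rw [meshPoint_eq_smul, meshPoint_eq_smul, dist_smul₀, Real.norm_eq_abs, abs_of_pos hδ]; nlinarith
  have hcd : dist (δ • faceCenter (hexp.cf i)) (meshPoint δ (hexp.cv i)) ≤ δ := by
    rw [meshPoint_eq_smul, dist_smul₀, Real.norm_eq_abs, abs_of_pos hδ]
    nlinarith [dist_faceCenter_toComplex_le (hexp.isCorner hin)]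
  refine ⟨z, hzfr, ?_, by linarith [dist_triangle z (meshPoint δ u') (meshPoint δ (hexp.cv i))]⟩
  -- the centre of `fᵢ` is in the component of the centre of `f_m`
  have hball' : ∀ j, i₀ ≤ j → j ≤ i₁ → closedBall (meshPoint δ (hexp.cv j)) δ ⊆ A := fun j h1 h2 =>
    (closedBall_subset_closedBall (by linarith)).trans (hball j h1 h2)
  have h1 := hexp.cf_mem_connectedComponentIn hδ' hi₁ hball' hi₀ hi hm₀ hm
  dsimp only at h1
  rw [connectedComponentIn_eq h1]
  -- the half-diagonal from the centre of `fᵢ` to `u'` misses the polygon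
  have hdiag : segment ℝ (meshPoint δ u') (δ • faceCenter (hexp.cf i)) ⊆ A \ hexp.pertTrace := by
    intro q hq
    refine ⟨hball i hi₀ hi ((convex_closedBall _ _).segment_subset (mem_closedBall.2 (by linarith)) (mem_closedBall.2 (by linarith)) hq), fun hqt => ?_⟩
    rw [meshPoint_eq_smul, mem_segment_smul_iff hδ.ne'] at hq
    obtain ⟨j, hj, hv, -, -⟩ := hexp.mem_dartPiece_of_mem_halfDiag hδ' hu' hqt hq
    exact hexp.cv_not_mem_zdArcB hadm j hj (hv ▸ hB)
  have h2 : meshPoint δ u' ∈ connectedComponentIn (A \ hexp.pertTrace) (δ • faceCenter (hexp.cf i)) :=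
    (convex_segment _ _).isPreconnected.subset_connectedComponentIn (right_mem_segment _ _ _) hdiag
      (left_mem_segment _ _ _)
  rw [connectedComponentIn_eq h2]
  have hseg : segment ℝ (meshPoint δ u') z ⊆ A \ hexp.pertTrace := fun q hq =>
    ⟨hball i hi₀ hi ((convex_closedBall _ _).segment_subset (mem_closedBall.2 (by linarith))
      (mem_closedBall.2 (by linarith [dist_triangle z (meshPoint δ u') (meshPoint δ (hexp.cv i))])) hq), hfree q hq⟩
  exact (convex_segment _ _).isPreconnected.subset_connectedComponentIn (left_mem_segment _ _ _) hseg
    (right_mem_segment _ _ _)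

/-! ### From a traversal to a stretch of darts -/

/-- **The polygon is within `δ` of the left vertex of its current dart** (arbitrary arcs;
`tIdx` form of `IsMedialExploration.dist_polyline_meshPoint_le`, with the corners `cv`).
[cite: Smirnov2001, §2] -/
theorem dist_polyline_cv_le_data (hδ : 0 < δ)
    (hexp : IsMedialExploration (⟨Dm.carrier, δ, arcA, arcB⟩ : DiscreteDobrushin) ω (a :: l)) (u : I) :
    dist (polyline ((a :: l).map (medialPoint δ)) u) (meshPoint δ (hexp.cv (tIdx l u))) ≤ δ :=
  hexp.dist_polyline_meshPoint_le (D := (⟨Dm.carrier, δ, arcA, arcB⟩ : DiscreteDobrushin)) hδ.le (fun _ hi => hexp.isCorner hi)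
    (fun _ hi => (hexp.corner_spec hi).2.2.1) (fun _ hi => (hexp.corner_spec hi).2.2.2) u

/-- `tIdx` is a valid dart index (arbitrary arcs). [folklore] -/
theorem tIdx_lt_data (hexp : IsMedialExploration (⟨Dm.carrier, δ, arcA, arcB⟩ : DiscreteDobrushin) ω (a :: l)) (u : I) :
    tIdx l u < ((a :: l).zip l).length := by
  have hl : l ≠ [] := by
    intro h; subst h; exact hexp.head_ne_getLast rfl
  have : 0 < l.length := List.length_pos_iff.2 hl
  rw [length_zip]; unfold tIdx; omega

/-- **Data of a traversal** (arbitrary arcs). Let the exploration polygon at mesh `δ ≤ ρ`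
traverse the shell `D(x; ρ, R)` between the times `s ≤ t`, with `R ≥ 16Cρ`, `C ≥ 16`. Then
there are dart indices `i' ≤ m ≤ j'` strictly between `tIdx s` and `tIdx t` such that: the
stretch over `[tIdx s, tIdx t]` joins the disc `B̄(x, 4ρ)` to the outside of `B(x, R/2)` (in one
of the two directions); the side segment of the middle dart `m` lies in the annulus
`𝔸 = B(x, R/2) ∖ B̄(x, 4ρ)`; the `4δ`-neighbourhoods of the vertices of the darts `i', …, j'`
lie in `𝔸`, these vertices being at distance within `δ` of `[Cρ, R/4]` from `x`; and the stretch
`i', …, j'` joins `B̄(x, Cρ + δ)` to the outside of `B(x, R/4 - δ)`.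
[cite: AizenmanBurchardDuke1999, Appendix A] -/
theorem traversal_data_data (hδ : 0 < δ) (hexp : IsMedialExploration (⟨Dm.carrier, δ, arcA, arcB⟩ : DiscreteDobrushin) ω (a :: l))
    {x : ℂ} {ρ R C : ℝ} (hδρ : δ ≤ ρ) (hC : 16 ≤ C) (hR : 16 * C * ρ ≤ R) {s t : I}
    (hst : (⟨polyline ((a :: l).map (medialPoint δ))⟩ : RandomPlanarGeometry.Curve ℂ).IsTraversal x ρ R s t) :
    ∃ m i' j' : ℕ, tIdx l s < m ∧ m < tIdx l t ∧ i' ≤ m ∧ m ≤ j' ∧ tIdx l s ≤ i' ∧ j' ≤ tIdx l t ∧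
      ((dist (hexp.pS (tIdx l s)) x ≤ 4 * ρ ∧ R / 2 ≤ dist (hexp.pT (tIdx l t)) x) ∨
        (R / 2 ≤ dist (hexp.pS (tIdx l s)) x ∧ dist (hexp.pT (tIdx l t)) x ≤ 4 * ρ)) ∧
      hexp.sideSeg m ⊆ ball x (R / 2) \ closedBall x (4 * ρ) ∧
      (∀ i, i' ≤ i → i ≤ j' →
        closedBall (meshPoint δ (hexp.cv i)) (4 * δ) ⊆ ball x (R / 2) \ closedBall x (4 * ρ)) ∧
      (∀ i, i' ≤ i → i ≤ j' →
        C * ρ - δ ≤ dist (meshPoint δ (hexp.cv i)) x ∧ dist (meshPoint δ (hexp.cv i)) x ≤ R / 4 + δ) ∧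
      ((dist (meshPoint δ (hexp.cv i')) x ≤ C * ρ + δ ∧ R / 4 - δ ≤ dist (meshPoint δ (hexp.cv j')) x) ∨
        (R / 4 - δ ≤ dist (meshPoint δ (hexp.cv i')) x ∧ dist (meshPoint δ (hexp.cv j')) x ≤ C * ρ + δ)) := by
  have hδ' : 0 < (⟨Dm.carrier, δ, arcA, arcB⟩ : DiscreteDobrushin).δ := hδ
  have hρ : 0 < ρ := hδ.trans_le hδρ
  set γ : I → ℂ := fun u => polyline ((a :: l).map (medialPoint δ)) u with hγ
  set f : I → ℝ := fun u => dist (γ u) x with hf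
  have hfc : Continuous f := ((polyline ((a :: l).map (medialPoint δ))).continuous).dist continuous_const
  have hcurve : ∀ u, (⟨polyline ((a :: l).map (medialPoint δ))⟩ : RandomPlanarGeometry.Curve ℂ) u = γ u := fun u => rfl
  -- the mesh point of `cv (tIdx u)` is within `δ` of `γ u`
  have hnear : ∀ u, dist (meshPoint δ (hexp.cv (tIdx l u))) x ≤ f u + δ ∧
      f u - δ ≤ dist (meshPoint δ (hexp.cv (tIdx l u))) x := by
    intro u
    have h := dist_polyline_cv_le_data hδ hexp u
    constructor
    · linarith [dist_triangle (meshPoint δ (hexp.cv (tIdx l u))) (γ u) x, dist_comm (γ u) (meshPoint δ (hexp.cv (tIdx l u)))]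
    · linarith [dist_triangle (γ u) (meshPoint δ (hexp.cv (tIdx l u))) x]
  -- shifted points of the dart `tIdx u` are within `3δ` of `γ u`
  have hpS : ∀ u, dist (hexp.pS (tIdx l u)) x ≤ f u + 3 * δ ∧ f u - 3 * δ ≤ dist (hexp.pT (tIdx l u)) x ∧
      f u - 3 * δ ≤ dist (hexp.pS (tIdx l u)) x ∧ dist (hexp.pT (tIdx l u)) x ≤ f u + 3 * δ := by
    intro u
    have h := dist_polyline_cv_le_data hδ hexp u
    have h1 := (hexp.dist_pS_le hδ' (tIdx_lt_data hexp u)).1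
    have h2 := (hexp.dist_pS_le hδ' (tIdx_lt_data hexp u)).2
    dsimp only at h1 h2
    refine ⟨?_, ?_, ?_, ?_⟩
    · linarith [dist_triangle (hexp.pS (tIdx l u)) (meshPoint δ (hexp.cv (tIdx l u))) x,
        dist_triangle (meshPoint δ (hexp.cv (tIdx l u))) (γ u) x,
        dist_comm (γ u) (meshPoint δ (hexp.cv (tIdx l u)))]
    · linarith [dist_triangle (γ u) (meshPoint δ (hexp.cv (tIdx l u))) x,
        dist_triangle (meshPoint δ (hexp.cv (tIdx l u))) (hexp.pT (tIdx l u)) x,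
        dist_comm (hexp.pT (tIdx l u)) (meshPoint δ (hexp.cv (tIdx l u)))]
    · linarith [dist_triangle (γ u) (meshPoint δ (hexp.cv (tIdx l u))) x,
        dist_triangle (meshPoint δ (hexp.cv (tIdx l u))) (hexp.pS (tIdx l u)) x,
        dist_comm (hexp.pS (tIdx l u)) (meshPoint δ (hexp.cv (tIdx l u)))]
    · linarith [dist_triangle (hexp.pT (tIdx l u)) (meshPoint δ (hexp.cv (tIdx l u))) x,
        dist_triangle (meshPoint δ (hexp.cv (tIdx l u))) (γ u) x,
        dist_comm (γ u) (meshPoint δ (hexp.cv (tIdx l u)))]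
  -- if two times have the same index, their positions are within `2δ`
  have hsame : ∀ u v, tIdx l u = tIdx l v → |f u - f v| ≤ 2 * δ := by
    intro u v huv
    have h1 := dist_polyline_cv_le_data hδ hexp u
    have h2 := dist_polyline_cv_le_data hδ hexp v
    rw [huv] at h1
    rw [abs_le]
    constructor <;> linarith [dist_triangle (γ u) (meshPoint δ (hexp.cv (tIdx l v))) x,
      dist_triangle (γ v) (meshPoint δ (hexp.cv (tIdx l v))) x,
      dist_triangle (meshPoint δ (hexp.cv (tIdx l v))) (γ u) x,
      dist_triangle (meshPoint δ (hexp.cv (tIdx l v))) (γ v) x,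
      dist_comm (γ u) (meshPoint δ (hexp.cv (tIdx l v))), dist_comm (γ v) (meshPoint δ (hexp.cv (tIdx l v)))]
  obtain ⟨hst0, hends⟩ := hst
  have hends' : (f s ≤ ρ ∧ R ≤ f t) ∨ (R ≤ f s ∧ f t ≤ ρ) := hends
  clear hends
  have hCρ : 16 * ρ ≤ C * ρ := mul_le_mul_of_nonneg_right hC hρ.le
  -- the tight crossing of `[Cρ, R/4]` and the middle time
  have hq : C * ρ < R / 4 := by linarith
  have key : ∀ {s₀ t₀ : I}, s ≤ s₀ → s₀ < t₀ → t₀ ≤ t →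
      ((f s₀ = C * ρ ∧ f t₀ = R / 4) ∨ (f s₀ = R / 4 ∧ f t₀ = C * ρ)) →
      (∀ u, s₀ ≤ u → u ≤ t₀ → C * ρ ≤ f u ∧ f u ≤ R / 4) →
      ∃ m i' j' : ℕ, tIdx l s < m ∧ m < tIdx l t ∧ i' ≤ m ∧ m ≤ j' ∧ tIdx l s ≤ i' ∧ j' ≤ tIdx l t ∧
        hexp.sideSeg m ⊆ ball x (R / 2) \ closedBall x (4 * ρ) ∧
        (∀ i, i' ≤ i → i ≤ j' →
          closedBall (meshPoint δ (hexp.cv i)) (4 * δ) ⊆ ball x (R / 2) \ closedBall x (4 * ρ)) ∧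
        (∀ i, i' ≤ i → i ≤ j' →
          C * ρ - δ ≤ dist (meshPoint δ (hexp.cv i)) x ∧ dist (meshPoint δ (hexp.cv i)) x ≤ R / 4 + δ) ∧
        ((dist (meshPoint δ (hexp.cv i')) x ≤ C * ρ + δ ∧ R / 4 - δ ≤ dist (meshPoint δ (hexp.cv j')) x) ∨
          (R / 4 - δ ≤ dist (meshPoint δ (hexp.cv i')) x ∧ dist (meshPoint δ (hexp.cv j')) x ≤ C * ρ + δ)) := by
    intro s₀ t₀ hss₀ hs₀t₀ ht₀t hlev hmid
    -- the middle time: `f u₀ = (Cρ + R/4)/2`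
    have hIVT : ∃ u₀ : I, s₀ ≤ u₀ ∧ u₀ ≤ t₀ ∧ f u₀ = (C * ρ + R / 4) / 2 := by
      rcases hlev with ⟨h1, h2⟩ | ⟨h1, h2⟩
      · have := intermediate_value_Icc hs₀t₀.le hfc.continuousOn
          (show (C * ρ + R / 4) / 2 ∈ Icc (f s₀) (f t₀) from ⟨by rw [h1]; linarith, by rw [h2]; linarith⟩)
        obtain ⟨u₀, ⟨hu1, hu2⟩, hu3⟩ := this
        exact ⟨u₀, hu1, hu2, hu3⟩
      · have := intermediate_value_Icc' hs₀t₀.le hfc.continuousOn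
          (show (C * ρ + R / 4) / 2 ∈ Icc (f t₀) (f s₀) from ⟨by rw [h2]; linarith, by rw [h1]; linarith⟩)
        obtain ⟨u₀, ⟨hu1, hu2⟩, hu3⟩ := this
        exact ⟨u₀, hu1, hu2, hu3⟩
    obtain ⟨u₀, hsu₀, hu₀t, hfu₀⟩ := hIVT
    refine ⟨tIdx l u₀, tIdx l s₀, tIdx l t₀, ?_, ?_, tIdx_mono l hsu₀, tIdx_mono l hu₀t,
      tIdx_mono l hss₀, tIdx_mono l ht₀t, ?_, ?_, ?_, ?_⟩
    · -- `tIdx s < tIdx u₀`: else `|f s - f u₀| ≤ 2δ`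
      refine lt_of_le_of_ne (tIdx_mono l (hss₀.trans hsu₀)) fun h => ?_
      have := hsame s u₀ h
      rw [abs_le] at this
      rcases hends' with ⟨h1, -⟩ | ⟨h1, -⟩ <;> linarith [this.1, this.2]
    · refine lt_of_le_of_ne (tIdx_mono l (hu₀t.trans ht₀t)) fun h => ?_
      have := hsame u₀ t h
      rw [abs_le] at this
      rcases hends' with ⟨-, h1⟩ | ⟨-, h1⟩ <;> linarith [this.1, this.2]
    · -- the side segment of the middle dart
      intro z hz
      have h1 := hexp.sideSeg_subset_closedBall hδ' (tIdx_lt_data hexp u₀) hz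
      dsimp only [leftPt] at h1
      rw [mem_closedBall] at h1
      have h2 := (hnear u₀).1
      have h3 := (hnear u₀).2
      rw [hfu₀] at h2 h3
      constructor
      · rw [mem_ball]
        linarith [dist_triangle z (meshPoint δ (hexp.cv (tIdx l u₀))) x]
      · rw [mem_closedBall, not_le]
        linarith [dist_triangle (meshPoint δ (hexp.cv (tIdx l u₀))) z x, dist_comm z (meshPoint δ (hexp.cv (tIdx l u₀)))]
    · intro i hi1 hi2 z hz
      obtain ⟨u, hu1, hu2, rfl⟩ := exists_time_of_tIdx l hs₀t₀.le hi1 hi2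
      obtain ⟨hm1, hm2⟩ := hmid u hu1 hu2
      rw [mem_closedBall] at hz
      have h2 := (hnear u).1
      have h3 := (hnear u).2
      constructor
      · rw [mem_ball]
        linarith [dist_triangle z (meshPoint δ (hexp.cv (tIdx l u))) x]
      · rw [mem_closedBall, not_le]
        linarith [dist_triangle (meshPoint δ (hexp.cv (tIdx l u))) z x, dist_comm z (meshPoint δ (hexp.cv (tIdx l u)))]
    · intro i hi1 hi2
      obtain ⟨u, hu1, hu2, rfl⟩ := exists_time_of_tIdx l hs₀t₀.le hi1 hi2
      obtain ⟨hm1, hm2⟩ := hmid u hu1 hu2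
      exact ⟨by linarith [(hnear u).2], by linarith [(hnear u).1]⟩
    · rcases hlev with ⟨h1, h2⟩ | ⟨h1, h2⟩
      · left
        exact ⟨by linarith [(hnear s₀).1], by linarith [(hnear t₀).2]⟩
      · right
        exact ⟨by linarith [(hnear s₀).2], by linarith [(hnear t₀).1]⟩
  rcases hends' with ⟨hs1, ht1⟩ | ⟨hs1, ht1⟩
  · obtain ⟨s₀, t₀, hss₀, hs₀t₀, ht₀t, hfs₀, hft₀, hmid⟩ :=
      exists_tight_crossing hfc hst0 hq (by linarith) (by linarith)
    obtain ⟨m, i', j', h1, h2, h3, h4, h5, h6, h7, h8, h9, h10⟩ :=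
      key hss₀ hs₀t₀ ht₀t (Or.inl ⟨hfs₀, hft₀⟩) hmid
    refine ⟨m, i', j', h1, h2, h3, h4, h5, h6, Or.inl ⟨?_, ?_⟩, h7, h8, h9, h10⟩
    · linarith [(hpS s).1]
    · linarith [(hpS t).2.1]
  · obtain ⟨s₀, t₀, hss₀, hs₀t₀, ht₀t, hfs₀, hft₀, hmid⟩ :=
      exists_tight_crossing' hfc hst0 hq (by linarith) (by linarith)
    obtain ⟨m, i', j', h1, h2, h3, h4, h5, h6, h7, h8, h9, h10⟩ :=
      key hss₀ hs₀t₀ ht₀t (Or.inr ⟨hfs₀, hft₀⟩) hmid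
    refine ⟨m, i', j', h1, h2, h3, h4, h5, h6, Or.inr ⟨?_, ?_⟩, h7, h8, h9, h10⟩
    · linarith [(hpS s).2.2.1]
    · linarith [(hpS t).2.2.2]

end Literature.Probability.Percolation

end
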